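import Summits.ResolutionOfSingularities.ResolutionOfSingularities.Theorems.FrobeniusClosingSteerReducedOrderWords
import Summits.ResolutionOfSingularities.ResolutionOfSingularities.Theorems.FrobeniusClosingSteerTwoOddIllegal
import Summits.ResolutionOfSingularities.ResolutionOfSingularities.Theorems.FrobeniusClosingSteerPolyCleanBound
import Summits.ResolutionOfSingularities.ResolutionOfSingularities.Theorems.FrobeniusClosingSteerPolyCleanBoundBelow
import HarnessLib

/-!
# Crux `Steer` (stmt-ResolutionOfSingularities-16345), chain W4.1 — hS1b words W-PC6a and W-TOI HOLD (by-name one-liners over the landed bodies)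

OURS (campaign `res-hironaka`, rung L ★L-G4, slot W4.1; seat res-D-lib-2 g10 on res-L0-w41-plan-1 RULING 284 (2)). The words file `…ReducedOrderWords`
(res-L0-w41-strat-2 g4, p566435) states W-PC6a `ReducedOrder.PolyCleanBound` and W-TOI `ReducedOrder.TwoOddIllegal`; their bodies are the landed theorems
`PolyCleanBound.sub_sq_not_mem_maximalIdeal_pow` and `TwoOddIllegal.isPermissibleCentre_of_two_odd` (binder for binder). This file records the two words as
THEOREMS BY NAME for the hS1b assembly chain (`…EventuallyConstantReducedOrder`, whose remaining binders are W-VM and W-ESC of A2). Candidates, not facts;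
nothing here is a statement of H. Hironaka's manuscript [Hironaka2017] (status: under review). AI-written; AI review is weaker than expert review.
-/

-- `Summit.<S>.<S>.…` duplicates the summit name by design (single-problem summit).
set_option linter.dupNamespace false

namespace Summit.ResolutionOfSingularities.ResolutionOfSingularities.Theorems.SwitchingDichotomy.ReducedOrder

/-- **W-PC6a holds.** OURS. [folklore] -/
theorem polyCleanBound_holds : PolyCleanBound := by
  intro k _ _ _ σ _ _ 𝔮 _ S _ _ _ _ g n hg hdeg
  exact PolyCleanBound.sub_sq_not_mem_maximalIdeal_pow k σ 𝔮 S g n hg hdeg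

/-- **W-TOI holds.** OURS. [folklore] -/
theorem twoOddIllegal_holds (K : Type) [Field K] : TwoOddIllegal K := by
  intro _ R _ hdim f a b ga gb hpa hab ham ha2 hP hreg hfa hfb h0 h1
  exact TwoOddIllegal.isPermissibleCentre_of_two_odd R hdim f a b ga gb hpa hab ham ha2 hP hreg hfa hfb h0 h1

/-- **W-PC6b holds** (appended by res-D-pv-028 g8 per res-L0-w41-plan-1 RULING 296: the landed body is
`PolyCleanBoundBelow.polyCleanBoundBelow`, p568716). OURS. [folklore] -/
theorem polyCleanBoundBelow_holds : PolyCleanBoundBelow :=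
  PolyCleanBoundBelow.polyCleanBoundBelow

end Summit.ResolutionOfSingularities.ResolutionOfSingularities.Theorems.SwitchingDichotomy.ReducedOrder
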